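import Literature.Probability.LatticeModels.DobrushinShlosmanWeightedInfiniteVolume
import Literature.Probability.LatticeModels.ONModelDobrushinStates
import HarnessLib

/-!
# The WEIGHTED Dobrushin–Shlosman window comparison, arbitrary range, for the CONDITIONAL specification: covariance
# decay of the finite-volume kernels `γ_Λ(· | η)` (interior form)

Topic `Literature/Probability/LatticeModels`; theorems only (no definition, no named fact). The kernel twin of
`DobrushinShlosmanWeightedInfiniteVolumeStates.lean`: the two-functional engine `abs_sub_le_window_weighted_infinite` (window
kernels of ARBITRARY range, weighted received sums) is run with `E₁ = γ_Λ(· | η)` — a Gibbs measure of Föllmer's conditional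
specification `π^{Λ,η}` (1988, Ch. I, (2.10)) — and `E₂` its tilt by the shifted density `g̃`; both are invariant under the window
kernels `γ_{win c}`, `win c ⊆ Λ`, avoiding the support of `g` (CONSISTENCY instead of the DLR equations; properness).

* `abs_covariance_kernel_le_of_window_weighted` — for EVERY finite `Λ`, EVERY boundary condition `η`:
  `|cov_{γ_Λ(·|η)}(f, g)| ≤ 2 R² (Σ δ_g) Σ_{x ∈ Δf} e^{−t ρ(x)} δ_f x` for every real profile `ρ ≤ 0` off `Λ` and on the sites of
  `Λ` in no usable window, `ρ x ≤ ρ y + d(c; y, x)` along the array;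
* `abs_covariance_kernel_le_of_window_weighted_exp` — `≤ 2 R² e^{−t m} (Σ δ_f)(Σ δ_g)` if `ρ ≥ m` on `Δf`.
This is the Kantorovich form of Dobrushin–Shlosman's finite-volume mixing for window conditions of infinite range, in the
INTERIOR form (the profile saturates near the sites whose windows leave `Λ`). The sitewise finite-range twin is
`DobrushinShlosmanKernel.lean`; the single-site twins are `DobrushinMetricInfiniteRangeKernel.lean` / `DobrushinComparisonBoundary.lean`.

## References
* H. Föllmer, *Random fields and diffusion processes*, LNM 1362 (1988), Ch. I (2.10), Thm. (2.13), Cor. (2.14).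
* H. Künsch, Comm. Math. Phys. 84 (1982) 207–222.
* H.-O. Georgii, *Gibbs Measures and Phase Transitions*, 2nd ed. (2011), Remark 8.26, §8.2.
* R. L. Dobrushin, S. B. Shlosman (1985), Thm. 1; J. Stat. Phys. 46 (1987) 983–1014.
-/

noncomputable section

open MeasureTheory ProbabilityTheory Finset Function Filter
open scoped Topology
open Literature.Probability.LatticeModels.DobrushinMetric (IsLipBound integrable_of_abs_le'
  abs_sub_le_mul_sum_of_dependsOn)

namespace Literature.Probability.LatticeModels.DobrushinShlosman

variable {V S : Type*} [MeasurableSpace S]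

/-- **Covariance decay of the finite-volume KERNELS under the weighted window condition, arbitrary range, arbitrary
index set, interior form** (Föllmer 1988 Ch. I Thm. (2.13) / Cor. (2.14) for the conditional specification (2.10);
Künsch 1982; Georgii 2011 Remark 8.26 — inside Dobrushin–Shlosman's window iteration). Setting of
`abs_sub_le_window_weighted_infinite` (global window contraction (H1), weighted received sums (H2) `≤ γ₀ < 1`). For
EVERY finite `Λ`, EVERY boundary condition `η`, bounded measurable `f, g` reading `Δf ⊆ Λ`, `Δg` with site-Lipschitz
vectors `δ_f, δ_g`, and every profile `ρ : V → ℝ` with `ρ ≤ 0` off `Λ`, `ρ ≤ 0` on the sites of `Λ` lying in no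
window `win c ⊆ Λ` (`c ∈ Λ`) that avoids `Δg`, and `ρ x ≤ ρ y + d(c; y, x)` along the support of the array of such
windows: `|cov_{γ_Λ(·|η)}(f, g)| ≤ 2 R² (Σ_{y ∈ Δg} δ_g y) Σ_{x ∈ Δf} e^{−t ρ(x)} δ_f x` — the kernel `γ_Λ(·|η)` and its
tilt are invariant under the windows inside `Λ` by CONSISTENCY and properness.
[cite: Follmer1988, Ch. I Theorem (2.13)] [cite: Georgii2011, Remark 8.26] -/
theorem abs_covariance_kernel_le_of_window_weighted [DecidableEq V] {γ : Specification V S}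
    (hγ : IsSpecification γ)
    {r : S → S → ℝ} {R : ℝ} (hr0 : ∀ a b, 0 ≤ r a b) (hrR : ∀ a b, r a b ≤ R) (hR : 0 ≤ R)
    (hrr : ∀ a, r a a = 0)
    {win : V → Finset V} {K : V → V → V → ℝ} (hK0 : ∀ c y x, 0 ≤ K c y x)
    (hcontract : ∀ (c : V) (ω η : V → S) (f : (V → S) → ℝ) (δ : V → ℝ), Measurable f →
      (∃ B, ∀ σ, |f σ| ≤ B) → DependsOn f (win c : Set V) → (∀ x, 0 ≤ δ x) →
      (∀ (x : V) (σ τ : V → S), (∀ v, v ≠ x → σ v = τ v) → |f σ - f τ| ≤ δ x * r (σ x) (τ x)) →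
        |∫ σ, f σ ∂(γ (win c) ω) - ∫ σ, f σ ∂(γ (win c) η)| ≤
          ∑ x ∈ win c, δ x * ∑' y, K c y x * r (ω y) (η y))
    {t : ℝ} (ht : 0 ≤ t) {d : V → V → V → ℝ} (hd0 : ∀ c y x, 0 ≤ d c y x)
    (hKs : ∀ c x, Summable fun y => K c y x * Real.exp (t * d c y x))
    {γ₀ : ℝ} (hγ₀ : 0 ≤ γ₀) (hγ₁ : γ₀ < 1)
    (hsumW : ∀ c, ∀ x ∈ win c, ∑' y, K c y x * Real.exp (t * d c y x) ≤ γ₀)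
    (Λ : Finset V) (η : V → S) {f g : (V → S) → ℝ} (hfm : Measurable f)
    (hgm : Measurable g) {Bf Bg : ℝ} (hBf : ∀ σ, |f σ| ≤ Bf) (hBg : ∀ σ, |g σ| ≤ Bg)
    {Δf Δg : Finset V} (hfdep : DependsOn f (Δf : Set V)) (hgdep : DependsOn g (Δg : Set V))
    {δf δg : V → ℝ} (hδf : IsLipBound r f δf) (hδg : IsLipBound r g δg)
    (hΔf : Δf ⊆ Λ) (ρ : V → ℝ) (hρout : ∀ y, y ∉ Λ → ρ y ≤ 0)
    (hρunc : ∀ x ∈ Λ, (∀ c ∈ Λ, win c ⊆ Λ → (∀ z ∈ win c, z ∉ Δg) → x ∉ win c) → ρ x ≤ 0)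
    (hρ : ∀ c ∈ Λ, win c ⊆ Λ → (∀ z ∈ win c, z ∉ Δg) → ∀ x ∈ win c, ∀ y, K c y x ≠ 0 →
      ρ x ≤ ρ y + d c y x) :
    |cov[f, g; γ Λ η]| ≤ 2 * R ^ 2 * (∑ y ∈ Δg, δg y) * ∑ x ∈ Δf, Real.exp (-(t * ρ x)) * δf x := by
  classical
  -- adapted from `abs_covariance_le_of_window_weighted` (Gibbs measure ↦ kernel; DLR ↦ consistency)
  haveI := hγ.isProbability Λ η
  set ν : Measure (V → S) := γ Λ η with hνdef
  obtain ⟨τ₀, -⟩ := nonempty_of_measure_ne_zero (μ := ν) (s := Set.univ) (by simp)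
  have hδg0 : ∀ y, 0 ≤ δg y := hδg.nonneg
  have hδf0 : ∀ x, 0 ≤ δf x := hδf.nonneg
  -- the shifted density `g̃ ∈ [0, 2 S_g]`
  set Sg : ℝ := R * ∑ y ∈ Δg, δg y with hSg
  have hSg0 : 0 ≤ Sg := mul_nonneg hR (Finset.sum_nonneg fun y _ => hδg0 y)
  have hosc : ∀ σ, |g σ - g τ₀| ≤ Sg := fun σ => abs_sub_le_mul_sum_of_dependsOn hrR hgdep hδg σ τ₀
  set gt : (V → S) → ℝ := fun σ => g σ + (Sg - g τ₀) with hgt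
  have hgt0 : ∀ σ, 0 ≤ gt σ := fun σ => by
    have := (abs_le.1 (hosc σ)).1; simp only [hgt]; linarith
  have hgtB : ∀ σ, gt σ ≤ 2 * Sg := fun σ => by
    have := (abs_le.1 (hosc σ)).2; simp only [hgt]; linarith
  have hgtm : Measurable gt := hgm.add_const _
  have hgtdep : DependsOn gt {v | (id v) ∈ Δg} := fun σ τ h => by
    simp only [hgt]; rw [hgdep h]
  have hgi : Integrable g ν := integrable_of_abs_le' hgm hBg
  have hgtabs : ∀ σ, |gt σ| ≤ 2 * Sg := fun σ => by
    rw [abs_of_nonneg (hgt0 σ)]; exact hgtB σ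
  have hgti : Integrable gt ν := integrable_of_abs_le' hgtm hgtabs
  -- the right-hand side is nonnegative
  have hRHS : 0 ≤ 2 * R ^ 2 * (∑ y ∈ Δg, δg y) * ∑ x ∈ Δf, Real.exp (-(t * ρ x)) * δf x := by
    have := Finset.sum_nonneg fun y (_ : y ∈ Δg) => hδg0 y
    have := Finset.sum_nonneg fun x (_ : x ∈ Δf) => mul_nonneg (Real.exp_nonneg (-(t * ρ x))) (hδf0 x)
    positivity
  -- `cov(f, g) = cov(f, g̃) = ν(f g̃) - ν(f) ν(g̃)`
  have hcov : cov[f, g; ν] = ∫ σ, f σ * gt σ ∂ν - (∫ σ, f σ ∂ν) * ∫ σ, gt σ ∂ν := by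
    have h1 : cov[f, g; ν] = cov[f, gt; ν] := by
      rw [hgt, covariance_add_const_right hgi]
    rw [h1, covariance_eq_sub]
    · rfl
    · exact memLp_of_bounded (a := -Bf) (b := Bf)
        (ae_of_all _ fun σ => abs_le.1 (hBf σ)) hfm.aestronglyMeasurable 2
    · exact memLp_of_bounded (a := -(2 * Sg)) (b := 2 * Sg)
        (ae_of_all _ fun σ => abs_le.1 (hgtabs σ)) hgtm.aestronglyMeasurable 2
  by_cases hz : ∫ σ, gt σ ∂ν = 0
  · -- degenerate case: `g̃ = 0` a.e., so the covariance vanishes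
    have hae : gt =ᵐ[ν] 0 := (integral_eq_zero_iff_of_nonneg (fun σ => hgt0 σ) hgti).1 hz
    have hfg : ∫ σ, f σ * gt σ ∂ν = 0 := by
      rw [← integral_zero (α := V → S) (μ := ν) (G := ℝ)]
      refine integral_congr_ae ?_
      filter_upwards [hae] with σ hσ
      simp [hσ]
    rw [hcov, hfg, hz, mul_zero, sub_zero, abs_zero]
    exact hRHS
  have hpos : 0 < ∫ σ, gt σ ∂ν := lt_of_le_of_ne (integral_nonneg hgt0) (Ne.symm hz)
  -- the two states: `ν` (invariant under every window kernel, DLR) and its tilt by `g̃` (invariant under the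
  -- windows avoiding `Δg`)
  set E₁ : ((V → S) → ℝ) → ℝ := fun F => ∫ σ, F σ ∂ν with hE₁
  set E₂ : ((V → S) → ℝ) → ℝ := fun F => (∫ σ, gt σ * F σ ∂ν) / ∫ σ, gt σ ∂ν with hE₂
  have h₁le : ∀ ⦃F : (V → S) → ℝ⦄ ⦃M : ℝ⦄, Measurable F → (∃ B, ∀ σ, |F σ| ≤ B) →
      (∀ σ, F σ ≤ M) → E₁ F ≤ M := by
    rintro F M hFm ⟨B, hB⟩ hM
    calc ∫ σ, F σ ∂ν ≤ ∫ _σ, M ∂ν := integral_mono (integrable_of_abs_le' hFm hB) (integrable_const M) hM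
      _ = M := by simp
  have h₁ge : ∀ ⦃F : (V → S) → ℝ⦄ ⦃M : ℝ⦄, Measurable F → (∃ B, ∀ σ, |F σ| ≤ B) →
      (∀ σ, M ≤ F σ) → M ≤ E₁ F := by
    rintro F M hFm ⟨B, hB⟩ hM
    calc M = ∫ _σ, M ∂ν := by simp
      _ ≤ ∫ σ, F σ ∂ν := integral_mono (integrable_const M) (integrable_of_abs_le' hFm hB) hM
  have h₁T : ∀ c ∈ Λ, win c ⊆ Λ → (∀ z ∈ win c, z ∉ Δg) → ∀ ⦃F : (V → S) → ℝ⦄, Measurable F →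
      (∃ B, ∀ σ, |F σ| ≤ B) → E₁ (fun σ => ∫ τ, F τ ∂(γ (win c) σ)) = E₁ F := by
    rintro c - hwc - F hFm ⟨B, hB⟩
    exact hγ.integral_integral_consistent hwc η (integrable_of_abs_le' hFm hB)
  have hgfi : ∀ {F : (V → S) → ℝ}, Measurable F → ∀ {B : ℝ}, (∀ σ, |F σ| ≤ B) →
      Integrable (fun σ => gt σ * F σ) ν := fun hFm B hB =>
    hgti.mul_bdd hFm.aestronglyMeasurable (ae_of_all _ fun σ => by rw [Real.norm_eq_abs]; exact hB σ)
  have h₂le : ∀ ⦃F : (V → S) → ℝ⦄ ⦃M : ℝ⦄, Measurable F → (∃ B, ∀ σ, |F σ| ≤ B) →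
      (∀ σ, F σ ≤ M) → E₂ F ≤ M := by
    rintro F M hFm ⟨B, hB⟩ hM
    change (∫ σ, gt σ * F σ ∂ν) / ∫ σ, gt σ ∂ν ≤ M
    rw [div_le_iff₀ hpos]
    calc ∫ σ, gt σ * F σ ∂ν ≤ ∫ σ, gt σ * M ∂ν :=
          integral_mono (hgfi hFm hB) (hgti.mul_const M) fun σ => mul_le_mul_of_nonneg_left (hM σ) (hgt0 σ)
      _ = M * ∫ σ, gt σ ∂ν := by rw [integral_mul_const, mul_comm]
  have h₂ge : ∀ ⦃F : (V → S) → ℝ⦄ ⦃M : ℝ⦄, Measurable F → (∃ B, ∀ σ, |F σ| ≤ B) →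
      (∀ σ, M ≤ F σ) → M ≤ E₂ F := by
    rintro F M hFm ⟨B, hB⟩ hM
    change M ≤ (∫ σ, gt σ * F σ ∂ν) / ∫ σ, gt σ ∂ν
    rw [le_div_iff₀ hpos]
    calc M * ∫ σ, gt σ ∂ν = ∫ σ, gt σ * M ∂ν := by rw [integral_mul_const, mul_comm]
      _ ≤ ∫ σ, gt σ * F σ ∂ν :=
          integral_mono (hgti.mul_const M) (hgfi hFm hB) fun σ => mul_le_mul_of_nonneg_left (hM σ) (hgt0 σ)
  have h₂T : ∀ c ∈ Λ, win c ⊆ Λ → (∀ z ∈ win c, z ∉ Δg) → ∀ ⦃F : (V → S) → ℝ⦄, Measurable F →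
      (∃ B, ∀ σ, |F σ| ≤ B) → E₂ (fun σ => ∫ τ, F τ ∂(γ (win c) σ)) = E₂ F := by
    rintro c - hwc hc F hFm ⟨B, hB⟩
    change (∫ ζ, gt ζ * (∫ σ, F σ ∂(γ (win c) ζ)) ∂ν) / ∫ σ, gt σ ∂ν = (∫ σ, gt σ * F σ ∂ν) / ∫ σ, gt σ ∂ν
    congr 1
    simp_rw [mul_windowAvg_eq_of_dependsOn hγ (cell := id) (W := win c) (fun v => Iff.rfl) hgtdep hc]
    exact hγ.integral_integral_consistent hwc η (hgfi hFm hB)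
  -- the two-functional comparison for `f`, with its Lipschitz vector cut down to `Δf`
  have hfdepΛ : DependsOn f (Λ : Set V) :=
    hfdep.mono fun v hv => Finset.mem_coe.2 (hΔf (Finset.mem_coe.1 hv))
  have key := abs_sub_le_window_weighted_infinite hγ hr0 hrR hR hrr hK0 hcontract ht hd0 hKs hγ₀ hγ₁ hsumW Λ
    (fun c => ∀ z ∈ win c, z ∉ Δg) h₁le h₁ge h₁T h₂le h₂ge h₂T ρ hρout hρunc hρ hfm hBf hfdepΛ
    (hδf.restrict hfdep)
  have hsumΔ : ∑ x ∈ Λ, Real.exp (-(t * ρ x)) * (if x ∈ Δf then δf x else 0) =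
      ∑ x ∈ Δf, Real.exp (-(t * ρ x)) * δf x := by
    have h1 : ∑ x ∈ Λ, Real.exp (-(t * ρ x)) * (if x ∈ Δf then δf x else 0) =
        ∑ x ∈ Λ, (if x ∈ Δf then Real.exp (-(t * ρ x)) * δf x else 0) :=
      Finset.sum_congr rfl fun x _ => by split_ifs <;> simp
    rw [h1, Finset.sum_ite_mem, Finset.inter_eq_right.2 hΔf]
  rw [hsumΔ] at key
  change |∫ σ, f σ ∂ν - (∫ σ, gt σ * f σ ∂ν) / ∫ σ, gt σ ∂ν| ≤
    R * ∑ x ∈ Δf, Real.exp (-(t * ρ x)) * δf x at key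
  -- `cov = ν(g̃) · (ν_{g̃}(f) - ν(f))`
  have hfgt : ∫ σ, f σ * gt σ ∂ν = ∫ σ, gt σ * f σ ∂ν :=
    integral_congr_ae (ae_of_all _ fun σ => mul_comm _ _)
  have hident : cov[f, g; ν] =
      (∫ σ, gt σ ∂ν) * ((∫ σ, gt σ * f σ ∂ν) / ∫ σ, gt σ ∂ν - ∫ σ, f σ ∂ν) := by
    rw [hcov, hfgt, mul_sub, mul_div_cancel₀ _ hz]
    ring
  rw [hident, abs_mul, abs_of_pos hpos, abs_sub_comm]
  have hgtint : ∫ σ, gt σ ∂ν ≤ 2 * Sg := by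
    calc ∫ σ, gt σ ∂ν ≤ ∫ _σ, 2 * Sg ∂ν := integral_mono hgti (integrable_const _) hgtB
      _ = 2 * Sg := by simp
  have hkey0 : 0 ≤ R * ∑ x ∈ Δf, Real.exp (-(t * ρ x)) * δf x :=
    mul_nonneg hR (Finset.sum_nonneg fun x _ => mul_nonneg (Real.exp_nonneg _) (hδf0 x))
  calc (∫ σ, gt σ ∂ν) * |∫ σ, f σ ∂ν - (∫ σ, gt σ * f σ ∂ν) / ∫ σ, gt σ ∂ν|
      ≤ (2 * Sg) * (R * ∑ x ∈ Δf, Real.exp (-(t * ρ x)) * δf x) :=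
        mul_le_mul hgtint key (abs_nonneg _) (by positivity)
    _ = 2 * R ^ 2 * (∑ y ∈ Δg, δg y) * ∑ x ∈ Δf, Real.exp (-(t * ρ x)) * δf x := by
        rw [hSg]; ring

/-- **Exponential covariance decay of the kernels, weighted form, arbitrary range and index set**: in the setting
of `abs_covariance_kernel_le_of_window_weighted`, if moreover `ρ ≥ m` on `Δf` then
`|cov_{γ_Λ(·|η)}(f, g)| ≤ 2 R² e^{−t m} (Σ_{Δf} δ_f)(Σ_{Δg} δ_g)` (Föllmer 1988 Ch. I Cor. (2.14) / Georgii 2011 Remark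
8.26, for the conditional specification). [cite: Follmer1988, Ch. I Corollary (2.14)] [cite: Georgii2011, Remark 8.26] -/
theorem abs_covariance_kernel_le_of_window_weighted_exp [DecidableEq V] {γ : Specification V S}
    (hγ : IsSpecification γ)
    {r : S → S → ℝ} {R : ℝ} (hr0 : ∀ a b, 0 ≤ r a b) (hrR : ∀ a b, r a b ≤ R) (hR : 0 ≤ R)
    (hrr : ∀ a, r a a = 0)
    {win : V → Finset V} {K : V → V → V → ℝ} (hK0 : ∀ c y x, 0 ≤ K c y x)
    (hcontract : ∀ (c : V) (ω η : V → S) (f : (V → S) → ℝ) (δ : V → ℝ), Measurable f →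
      (∃ B, ∀ σ, |f σ| ≤ B) → DependsOn f (win c : Set V) → (∀ x, 0 ≤ δ x) →
      (∀ (x : V) (σ τ : V → S), (∀ v, v ≠ x → σ v = τ v) → |f σ - f τ| ≤ δ x * r (σ x) (τ x)) →
        |∫ σ, f σ ∂(γ (win c) ω) - ∫ σ, f σ ∂(γ (win c) η)| ≤
          ∑ x ∈ win c, δ x * ∑' y, K c y x * r (ω y) (η y))
    {t : ℝ} (ht : 0 ≤ t) {d : V → V → V → ℝ} (hd0 : ∀ c y x, 0 ≤ d c y x)
    (hKs : ∀ c x, Summable fun y => K c y x * Real.exp (t * d c y x))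
    {γ₀ : ℝ} (hγ₀ : 0 ≤ γ₀) (hγ₁ : γ₀ < 1)
    (hsumW : ∀ c, ∀ x ∈ win c, ∑' y, K c y x * Real.exp (t * d c y x) ≤ γ₀)
    (Λ : Finset V) (η : V → S) {f g : (V → S) → ℝ} (hfm : Measurable f)
    (hgm : Measurable g) {Bf Bg : ℝ} (hBf : ∀ σ, |f σ| ≤ Bf) (hBg : ∀ σ, |g σ| ≤ Bg)
    {Δf Δg : Finset V} (hfdep : DependsOn f (Δf : Set V)) (hgdep : DependsOn g (Δg : Set V))
    {δf δg : V → ℝ} (hδf : IsLipBound r f δf) (hδg : IsLipBound r g δg)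
    (hΔf : Δf ⊆ Λ) (ρ : V → ℝ) (hρout : ∀ y, y ∉ Λ → ρ y ≤ 0)
    (hρunc : ∀ x ∈ Λ, (∀ c ∈ Λ, win c ⊆ Λ → (∀ z ∈ win c, z ∉ Δg) → x ∉ win c) → ρ x ≤ 0)
    (hρ : ∀ c ∈ Λ, win c ⊆ Λ → (∀ z ∈ win c, z ∉ Δg) → ∀ x ∈ win c, ∀ y, K c y x ≠ 0 →
      ρ x ≤ ρ y + d c y x)
    {m : ℝ} (hm : ∀ x ∈ Δf, m ≤ ρ x) :
    |cov[f, g; γ Λ η]| ≤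
      2 * R ^ 2 * Real.exp (-(t * m)) * (∑ x ∈ Δf, δf x) * ∑ y ∈ Δg, δg y := by
  have h := abs_covariance_kernel_le_of_window_weighted hγ hr0 hrR hR hrr hK0 hcontract ht hd0 hKs hγ₀ hγ₁ hsumW Λ η
    hfm hgm hBf hBg hfdep hgdep hδf hδg hΔf ρ hρout hρunc hρ
  refine h.trans ?_
  have hθ : ∑ x ∈ Δf, Real.exp (-(t * ρ x)) * δf x ≤ Real.exp (-(t * m)) * ∑ x ∈ Δf, δf x := by
    rw [Finset.mul_sum]
    refine Finset.sum_le_sum fun x hx => mul_le_mul_of_nonneg_right ?_ (hδf.nonneg x)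
    exact Real.exp_le_exp.2 (by nlinarith [hm x hx, ht])
  have hg0 : 0 ≤ ∑ y ∈ Δg, δg y := Finset.sum_nonneg fun y _ => hδg.nonneg y
  calc 2 * R ^ 2 * (∑ y ∈ Δg, δg y) * ∑ x ∈ Δf, Real.exp (-(t * ρ x)) * δf x
      ≤ 2 * R ^ 2 * (∑ y ∈ Δg, δg y) * (Real.exp (-(t * m)) * ∑ x ∈ Δf, δf x) :=
        mul_le_mul_of_nonneg_left hθ (by positivity)
    _ = 2 * R ^ 2 * Real.exp (-(t * m)) * (∑ x ∈ Δf, δf x) * ∑ y ∈ Δg, δg y := by ring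

end Literature.Probability.LatticeModels.DobrushinShlosman

end
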